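import Summits.QuantumAdvantage.QuantumAdvantage.Theorems.CubicForrelationNearExactIsExactKtGapRestrict
import Summits.QuantumAdvantage.QuantumAdvantage.Theorems.CubicForrelationNearExactIsExactKtThreeStructure
import Summits.QuantumAdvantage.QuantumAdvantage.Theorems.CubicForrelationNearExactIsExactCubicFormSymplecticCoords
import Summits.QuantumAdvantage.QuantumAdvantage.Theorems.CubicForrelationNearExactIsExactCubicFormRadical

/-!
# Crux `CubicForrelation.NearExactIsExact` (stmt-QuantumAdvantage-14043) — CELL LEMMA L3 (`t̄ = T ⊕ T′`): a cell of weight `< 160` with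
  cubic form `s₀s₁s₂ ⊕ s₃s₄s₅` has no quadratic terms through the radical `R₃ = ⟨e₆, e₇, e₈⟩`

Certificate seat `b2b-cforr-cert` (gen 41).  HONEST FRAMING: kernel-checked (standard axioms) proof of cell lemma L3 of
HOME/b2b-cforr-cert-g37/R2-PARTNER.md §3 / HOME/b2b-cforr-cert-g39/E1280-HANDPROOFS.md App. A ("T⊕T′: G, Γ vanish on R₃ × S"), for which
no written proof existed (g36 "64 sub-cell argument").  NEW PROOF: let `u ∈ R₃`; the derivative `L = D_u f` is affine (the cubic form
vanishes on `u`), say with linear part `ℓ`.  If `ℓ ≠ 0`: on `{L = 1}` the translation by `u` flips `f`, so `wt f = 128 + #{f = 1, L = 0}`,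
hence `#{f = 1, L = 0} < 32`; the restriction of `f` to the hyperplane `{L = 0}` is a cubic on `8` bits (`ktg_restrict`) of weight `< 32 =
2⁸⁻³`, so it vanishes (Kasami–Tokura, `kt3_weights_weak_all`); but `ker ℓ` contains three vectors `a, b, c` with `t̄(a,b,c) = 1` (built from
`e₀..e₅`), and the third derivative of `f` at a point of `{L = 0}` in these directions only sees zeros — contradiction.  So `ℓ = 0`:
`D_u f` is constant, i.e. `β(u, ·) = 0`.  Nothing about `θ₁₂`; NOT summit progress.

* `tl3_radical_rows`: the statement, on `Fin 9` with `t̄ = per(0,1,2) ⊕ per(3,4,5)` and `u` supported on `{6,7,8}`.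
* `tl3_matrix_rows` (appended): the same as the vanishing of the rows `j ≥ 6` of the second-difference matrix at unit vectors.

References: R2-PARTNER.md §3 (L3); T. Kasami, N. Tokura (1970); MacWilliams–Sloane Ch. 15.  Axioms: the standard three.
-/

set_option linter.dupNamespace false -- D-0017: single-problem summit ⇒ `QuantumAdvantage.QuantumAdvantage` by design

namespace Summit.QuantumAdvantage.QuantumAdvantage.Theorems.CubicForrelation.NearExactIsExact

open Finset
open Literature.Computability.QuantumComplexity
open Literature.Computability.QuantumComplexity.BuzetChailloux (bxor zeroVec bxor_comm bxor_self bxor_zeroVec zeroVec_bxor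
  bxor_bxor_cancel_left)

/-- **Cell lemma L3.**  `f` a cubic on `9` bits whose cubic form is that of `s₀s₁s₂ ⊕ s₃s₄s₅`, of weight `< 160`; then for every `u`
supported on `{6,7,8}` the derivative `D_u f` is constant (`β(u,·) = 0`). [this work; R2-PARTNER §3 L3] -/
theorem tl3_radical_rows (f : (Fin 9 → Bool) → Bool) (hf : IsDegLeFun 3 f)
    (hT : ∀ u v w x : Fin 9 → Bool,
      (((f x ^^ f (bxor x w)) ^^ (f (bxor x v) ^^ f (bxor (bxor x v) w))) ^^
          ((f (bxor x u) ^^ f (bxor (bxor x u) w)) ^^ (f (bxor (bxor x u) v) ^^ f (bxor (bxor (bxor x u) v) w)))) =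
        (((((u 0 && (v 1 && w 2)) ^^ (u 0 && (v 2 && w 1))) ^^ ((u 1 && (v 0 && w 2)) ^^ (u 1 && (v 2 && w 0)))) ^^
            ((u 2 && (v 0 && w 1)) ^^ (u 2 && (v 1 && w 0)))) ^^
         ((((u 3 && (v 4 && w 5)) ^^ (u 3 && (v 5 && w 4))) ^^ ((u 4 && (v 3 && w 5)) ^^ (u 4 && (v 5 && w 3)))) ^^
            ((u 5 && (v 3 && w 4)) ^^ (u 5 && (v 4 && w 3))))))
    (hwt : #(univ.filter fun x : Fin 9 → Bool => f x = true) < 160)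
    (u : Fin 9 → Bool) (hu : ∀ i : Fin 9, i.val < 6 → u i = false) (v : Fin 9 → Bool) :
    (f (bxor v u) ^^ f v) = (f u ^^ f zeroVec) := by
  classical
  -- the derivative `L = D_u f` and its linear part `ℓ`
  set L : (Fin 9 → Bool) → Bool := fun x => (f (bxor x u) ^^ f x) with hL
  have hu0 : u 0 = false := hu 0 (by decide)
  have hu1 : u 1 = false := hu 1 (by decide)
  have hu2 : u 2 = false := hu 2 (by decide)
  have hu3 : u 3 = false := hu 3 (by decide)
  have hu4 : u 4 = false := hu 4 (by decide)
  have hu5 : u 5 = false := hu 5 (by decide)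
  -- `L` is affine: its second derivative vanishes (the cubic form vanishes on `u`)
  have hLaff : ∀ x y, L (bxor x y) = ((L x ^^ L y) ^^ L zeroVec) := by
    intro x y
    have e := hT u x y zeroVec
    simp only [zeroVec_bxor, hu0, hu1, hu2, hu3, hu4, hu5, Bool.false_and, Bool.xor_false] at e
    simp only [hL]
    rw [bxor_comm (bxor x y) u, show bxor u (bxor x y) = bxor (bxor u x) y by rw [iw_bxor_assoc], bxor_comm x u,
      bxor_comm y u, zeroVec_bxor]
    revert e
    cases f zeroVec <;> cases f y <;> cases f x <;> cases f (bxor x y) <;> cases f u <;> cases f (bxor u y) <;>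
      cases f (bxor u x) <;> cases f (bxor (bxor u x) y) <;> decide
  set ℓ : (Fin 9 → Bool) → Bool := fun x => (L x ^^ L zeroVec) with hℓ
  have hℓadd : ∀ x y, ℓ (bxor x y) = (ℓ x ^^ ℓ y) := by
    intro x y; simp only [hℓ]; rw [hLaff]; cases L x <;> cases L y <;> cases L zeroVec <;> rfl
  -- goal: `ℓ v = 0`
  suffices hℓ0 : ∀ x, ℓ x = false by
    have e := hℓ0 v
    simp only [hℓ, hL, zeroVec_bxor] at e
    revert e; cases f (bxor v u) <;> cases f v <;> cases f u <;> cases f zeroVec <;> decide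
  by_contra hne
  push Not at hne
  obtain ⟨v₀, hv₀⟩ := hne
  have hv₀' : ℓ v₀ = true := by revert hv₀; cases ℓ v₀ <;> simp
  -- (1) `#{L = 1} = 256` and `f` is balanced on it
  have hU : #(univ : Finset (Fin 9 → Bool)) = 512 := by
    rw [card_univ, Fintype.card_fun, Fintype.card_bool, Fintype.card_fin]; rfl
  have hS₁ : 2 * #(univ.filter fun x : Fin 9 → Bool => L x = true) = 512 := by
    have e := (tce_half (univ : Finset (Fin 9 → Bool)) v₀ L (fun _ _ => mem_univ _) fun x _ => ?_).1
    · rw [hU] at e; exact e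
    · have e1 := hLaff x v₀
      have e2 : (L v₀ ^^ L zeroVec) = true := hv₀'
      rw [e1]; revert e2; cases L x <;> cases L v₀ <;> cases L zeroVec <;> decide
  have hhalf : 2 * #((univ.filter fun x : Fin 9 → Bool => L x = true).filter fun x => f x = true) =
      #(univ.filter fun x : Fin 9 → Bool => L x = true) := by
    refine (tce_half _ u f (fun x hx => ?_) (fun x hx => ?_)).1
    · rw [mem_filter] at hx ⊢
      refine ⟨mem_univ _, ?_⟩
      rw [← hx.2]
      simp only [hL]
      rw [iw_bxor_assoc, bxor_self, bxor_zeroVec]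
      cases f x <;> cases f (bxor x u) <;> rfl
    · have hx2 := (mem_filter.1 hx).2
      simp only [hL] at hx2
      revert hx2; cases f (bxor x u) <;> cases f x <;> simp
  -- (2) hence fewer than `32` ones of `f` lie in `{L = 0}`
  have hsplit := card_filter_add_card_filter_not (s := univ.filter fun x : Fin 9 → Bool => f x = true) (fun x => L x = true)
  have hA1 : #((univ.filter fun x : Fin 9 → Bool => f x = true).filter fun x => L x = true) =
      #((univ.filter fun x : Fin 9 → Bool => L x = true).filter fun x => f x = true) := by
    rw [filter_filter, filter_filter]; exact congrArg card (filter_congr fun x _ => and_comm)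
  have hA0 : #((univ.filter fun x : Fin 9 → Bool => f x = true).filter fun x => ¬ L x = true) < 32 := by omega
  -- (3) the restriction of `f` to `{L = 0}` is a cubic on `8` bits; by Kasami–Tokura it vanishes
  set z : Fin 9 → Bool := fun i => ℓ (fun l => decide (l = i)) with hz
  have hpar : ∀ x, ℓ x = decide (Odd #(univ.filter fun j => (x j && z j) = true)) := fun x => by
    rw [tsc_additive_parity ℓ hℓadd x]
  obtain ⟨i₀, hi₀⟩ : ∃ i, z i = true := by
    by_contra hnone
    push Not at hnone
    have e := hpar v₀
    rw [hv₀', filter_false_of_mem fun j _ => by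
      have hj' : z j = false := by have := hnone j; revert this; cases z j <;> simp
      rw [hj', Bool.and_false]; exact Bool.false_ne_true] at e
    simp at e
  obtain ⟨c', hc', hcard⟩ := ktg_restrict (k := 8) f hf z i₀ hi₀ (L zeroVec)
  have hset : (univ.filter fun x : Fin 9 → Bool => f x = true ∧ decide (Odd #(univ.filter fun i => (x i && z i) = true)) = L zeroVec) =
      (univ.filter fun x : Fin 9 → Bool => f x = true).filter fun x => ¬ L x = true := by
    rw [filter_filter]
    refine filter_congr fun x _ => ?_
    rw [← hpar x]
    simp only [hℓ]
    cases L x <;> cases L zeroVec <;> simp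
  have hc'card : #(univ.filter fun y : Fin 8 → Bool => c' y = true) < 32 := by
    have e : #(univ.filter fun y : Fin 8 → Bool => c' y = true) =
        #((univ.filter fun x : Fin 9 → Bool => f x = true).filter fun x => ¬ L x = true) := by rw [hcard, ← hset]
    omega
  have hc'zero : #(univ.filter fun y : Fin 8 → Bool => c' y = true) = 0 := by
    rcases kt3_weights_weak_all 8 c' hc' (by norm_num; omega) with h0 | ⟨i, hi, hi'⟩
    · exact h0
    · exfalso; norm_num at hi hi'; omega
  have hzero : ∀ x, L x = false → f x = false := by
    intro x hx
    have hempty : (univ.filter fun x : Fin 9 → Bool => f x = true).filter (fun x => ¬ L x = true) = ∅ := by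
      rw [← card_eq_zero, ← hset, ← hcard, hc'zero]
    by_contra hfx
    have hfx' : f x = true := by revert hfx; cases f x <;> simp
    have : x ∈ (univ.filter fun x : Fin 9 → Bool => f x = true).filter (fun x => ¬ L x = true) :=
      mem_filter.2 ⟨mem_filter.2 ⟨mem_univ _, hfx'⟩, by rw [hx]; exact Bool.false_ne_true⟩
    rw [hempty] at this
    exact notMem_empty _ this
  -- (4) a base point in `{L = 0}` and the value of `L` on its translates by `ker ℓ`
  obtain ⟨x₀, hx₀⟩ : ∃ x₀, L x₀ = false := by
    cases h0 : L zeroVec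
    · exact ⟨zeroVec, h0⟩
    · refine ⟨v₀, ?_⟩
      have e : (L v₀ ^^ L zeroVec) = true := hv₀'
      rw [h0] at e; revert e; cases L v₀ <;> decide
  have hLtr : ∀ s, ℓ s = false → ∀ x, L x = false → L (bxor x s) = false := by
    intro s hs x hx
    have e := hLaff x s
    have e2 : (L s ^^ L zeroVec) = false := hs
    rw [hx] at e; rw [e]; revert e2; cases L s <;> cases L zeroVec <;> decide
  -- the third derivative at `x₀` in three directions of `ker ℓ` vanishes
  have hD3 : ∀ a b c, ℓ a = false → ℓ b = false → ℓ c = false →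
      (((f x₀ ^^ f (bxor x₀ c)) ^^ (f (bxor x₀ b) ^^ f (bxor (bxor x₀ b) c))) ^^
          ((f (bxor x₀ a) ^^ f (bxor (bxor x₀ a) c)) ^^ (f (bxor (bxor x₀ a) b) ^^ f (bxor (bxor (bxor x₀ a) b) c)))) = false := by
    intro a b c ha hb hc
    have h1 := hLtr c hc x₀ hx₀
    have h2 := hLtr b hb x₀ hx₀
    have h3 := hLtr c hc _ h2
    have h4 := hLtr a ha x₀ hx₀
    have h5 := hLtr c hc _ h4
    have h6 := hLtr b hb _ h4
    have h7 := hLtr c hc _ h6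
    rw [hzero _ hx₀, hzero _ h1, hzero _ h2, hzero _ h3, hzero _ h4, hzero _ h5, hzero _ h6, hzero _ h7]
    rfl
  -- values of `ℓ` at unit vectors are the bits of `z`
  have hzu : ∀ i : Fin 9, ℓ (fun l => decide (l = i)) = z i := fun i => rfl
  -- (5) three directions in `ker ℓ` on which the cubic form is `1`
  by_cases h345 : z 3 = false ∧ z 4 = false ∧ z 5 = false
  · obtain ⟨h3, h4, h5⟩ := h345
    have e := hT (fun l => decide (l = 3)) (fun l => decide (l = 4)) (fun l => decide (l = 5)) x₀
    rw [hD3 _ _ _ (by rw [hzu]; exact h3) (by rw [hzu]; exact h4) (by rw [hzu]; exact h5)] at e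
    revert e; decide
  · -- some `j ∈ {3,4,5}` has `z j = 1`: pair it with the `eₜ`, `t ∈ {0,1,2}`, that are not in `ker ℓ`
    have hj : ∃ j : Fin 9, (j = 3 ∨ j = 4 ∨ j = 5) ∧ z j = true := by
      by_contra hno
      push Not at hno
      apply h345
      refine ⟨?_, ?_, ?_⟩
      · have := hno 3 (Or.inl rfl); revert this; cases z 3 <;> simp
      · have := hno 4 (Or.inr (Or.inl rfl)); revert this; cases z 4 <;> simp
      · have := hno 5 (Or.inr (Or.inr rfl)); revert this; cases z 5 <;> simp
    obtain ⟨j, hj345, hzj⟩ := hj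
    -- the corrected unit vectors
    have hdir : ∀ t : Fin 9, ℓ (if z t = true then bxor (fun l => decide (l = t)) (fun l => decide (l = j))
        else fun l => decide (l = t)) = false := by
      intro t
      split_ifs with ht
      · rw [hℓadd, hzu, hzu, ht, hzj]; rfl
      · rw [hzu]; revert ht; cases z t <;> simp
    have e := hT (if z 0 = true then bxor (fun l => decide (l = 0)) (fun l => decide (l = j)) else fun l => decide (l = 0))
      (if z 1 = true then bxor (fun l => decide (l = 1)) (fun l => decide (l = j)) else fun l => decide (l = 1))
      (if z 2 = true then bxor (fun l => decide (l = 2)) (fun l => decide (l = j)) else fun l => decide (l = 2)) x₀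
    rw [hD3 _ _ _ (hdir 0) (hdir 1) (hdir 2)] at e
    revert e
    rcases hj345 with rfl | rfl | rfl <;> cases z 0 <;> cases z 1 <;> cases z 2 <;> decide

/-- **L3 in matrix form.**  For `f` as in `tl3_radical_rows` and the second-difference matrix
`A(j,k) := f(0) ⊕ f(e_k) ⊕ f(e_j) ⊕ f(e_j ⊕ e_k)`: `A(j,k) = 0` for every row `j ≥ 6` (rows through the radical `R₃`) — the format
"`G`, `Γ` vanish on `R₃ × S`" of E1280-HANDPROOFS §1.7. [this work] -/
theorem tl3_matrix_rows (f : (Fin 9 → Bool) → Bool) (hf : IsDegLeFun 3 f)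
    (hT : ∀ u v w x : Fin 9 → Bool,
      (((f x ^^ f (bxor x w)) ^^ (f (bxor x v) ^^ f (bxor (bxor x v) w))) ^^
          ((f (bxor x u) ^^ f (bxor (bxor x u) w)) ^^ (f (bxor (bxor x u) v) ^^ f (bxor (bxor (bxor x u) v) w)))) =
        (((((u 0 && (v 1 && w 2)) ^^ (u 0 && (v 2 && w 1))) ^^ ((u 1 && (v 0 && w 2)) ^^ (u 1 && (v 2 && w 0)))) ^^
            ((u 2 && (v 0 && w 1)) ^^ (u 2 && (v 1 && w 0)))) ^^
         ((((u 3 && (v 4 && w 5)) ^^ (u 3 && (v 5 && w 4))) ^^ ((u 4 && (v 3 && w 5)) ^^ (u 4 && (v 5 && w 3)))) ^^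
            ((u 5 && (v 3 && w 4)) ^^ (u 5 && (v 4 && w 3))))))
    (hwt : #(univ.filter fun x : Fin 9 → Bool => f x = true) < 160) (j k : Fin 9) (hj : 6 ≤ j.val) :
    ((f zeroVec ^^ f (fun l => decide (l = k))) ^^
      (f (fun l => decide (l = j)) ^^ f (bxor (fun l => decide (l = j)) (fun l => decide (l = k))))) = false := by
  have hu : ∀ i : Fin 9, i.val < 6 → (fun l : Fin 9 => decide (l = j)) i = false := fun i hi => by
    show decide (i = j) = false
    exact decide_eq_false fun h => by subst h; omega
  have e := tl3_radical_rows f hf hT hwt (fun l => decide (l = j)) hu (fun l => decide (l = k))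
  rw [bxor_comm] at e
  revert e
  cases f zeroVec <;> cases f (fun l => decide (l = k)) <;> cases f (fun l => decide (l = j)) <;>
    cases f (bxor (fun l => decide (l = j)) (fun l => decide (l = k))) <;> decide

end Summit.QuantumAdvantage.QuantumAdvantage.Theorems.CubicForrelation.NearExactIsExact
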